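import Summits.AnomalousDissipation.AnomalousDissipation.Theorems.BaireTransferDenseLoudDesignerForcesErgodicModelMeasure

/-!
# The model measure, continuity on the core only (registered tools stub S6e of the crux `DenseLoudDesignerForces`,
# line ergodic-budget-selection-closing, block N)

Variant of the landed `stub_modelMeasureTools` (`…ErgodicModelMeasure.lean`): the continuity hypothesis on the model maps
`g t` is asked on the compact set `Λ` only (where the model map is a genuine conjugate of the phase for every `t ≥ 0`), not on
an open neighbourhood.  Continuity entered the original proof only through a.e.-measurability of `g t` for the pulled-back
measure `μ.comap Smap`, which is carried by `Λ`; so `ContinuousOn (g t) Λ` suffices verbatim.  Everything else is reused from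
that file (`stub_modelMeasureTools_aux_comap_compl`, `stub_modelMeasureTools_aux_map_comap`).
-/

set_option linter.dupNamespace false

noncomputable section

open scoped BigOperators Topology ENNReal InnerProductSpace
open Filter Set Function MeasureTheory

namespace Summit.AnomalousDissipation.AnomalousDissipation.Theorems.DenseLoudDesignerForces.Ergodic

open Literature.Analysis.FunctionSpaces Literature.Analysis.FunctionSpaces.Torus
open Literature.Analysis.FluidPDE Literature.Analysis.FluidPDE.Torus

/-- **The model measure through the smoothing isomorphism, continuity on the core only** (registered tools stub S6e): for an
injective bounded `Smap`, a compact `Λ`, maps `g t` continuous ON `Λ`, mapping `Λ` into itself and conjugated there to `φ t` by `Smap`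
(`t ≥ 0`), and a `φ`-invariant probability measure `μ` carried by `Smap '' Λ`, the pullback `m := μ.comap Smap` is a probability measure
carried by `Λ`, `g t`-invariant, with `Measure.map Smap m = μ` and `m (Smap ⁻¹' s) = 0` for `μ`-null `s` (Lusin–Souslin measurable
embedding on the Polish space `Hsp`, exactly as in `stub_modelMeasureTools`). [cite: FMRTTurbulence2001, Ch. IV §2 Def. 2.1 (invariant measures)] -/
theorem stub_modelMeasureCoreTools (Smap : Hsp →L[ℝ] Hsp) (hinj : Function.Injective Smap) {Λ : Set Hsp} (hΛ : IsCompact Λ)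
    {g φ : ℝ → Hsp → Hsp} (hg : ∀ t : ℝ, 0 ≤ t → ContinuousOn (g t) Λ)
    (hmaps : ∀ t : ℝ, 0 ≤ t → MapsTo (g t) Λ Λ) (hconj : ∀ t : ℝ, 0 ≤ t → ∀ y ∈ Λ, Smap (g t y) = φ t (Smap y))
    {μ : Measure Hsp} (hμ : IsInvariantMeasure (Smap '' Λ) φ μ) :
    ∃ m : Measure Hsp, IsProbabilityMeasure m ∧ m Λᶜ = 0 ∧ (∀ t : ℝ, 0 ≤ t → Measure.map (g t) m = m) ∧
      Measure.map Smap m = μ ∧ ∀ s : Set Hsp, μ s = 0 → m (Smap ⁻¹' s) = 0 := by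
  haveI : Fact ((2 : ℝ≥0∞) ≠ ∞) := ⟨ENNReal.ofNat_ne_top⟩
  haveI : SecondCountableTopology Hsp := TopologicalSpace.Subtype.secondCountableTopology _
  haveI : PolishSpace Hsp := ⟨⟩
  haveI : IsProbabilityMeasure μ := hμ.prob
  have hemb : MeasurableEmbedding Smap := Smap.continuous.measurableEmbedding hinj
  have hnull : μ (Smap '' Λ)ᶜ = 0 := hμ.null_compl
  have hmΛ : μ.comap Smap Λᶜ = 0 := stub_modelMeasureTools_aux_comap_compl hemb hnull
  have hmap : Measure.map Smap (μ.comap Smap) = μ := by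
    rw [hemb.map_comap]
    refine Measure.restrict_eq_self_of_ae_mem ?_
    rw [ae_iff]
    exact measure_mono_null (fun x hx hx' => hx (image_subset_range _ _ hx')) hnull
  refine ⟨μ.comap Smap, ?_, hmΛ, fun t ht => ?_, hmap, fun s hs => ?_⟩
  · haveI : IsProbabilityMeasure (Measure.map Smap (μ.comap Smap)) := by
      rw [hmap]
      infer_instance
    exact Measure.isProbabilityMeasure_of_map Smap
  · -- invariance under `g_t`, `t ≥ 0`; a.e.-measurability from continuity ON `Λ`, which carries `μ.comap Smap`
    have hmU : ∀ᵐ x ∂(μ.comap Smap), x ∈ Λ := by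
      rw [ae_iff]
      exact measure_mono_null (fun x hx hxΛ => hx hxΛ) hmΛ
    have hgae : AEMeasurable (g t) (μ.comap Smap) := by
      have h := (hg t ht).aemeasurable (μ := μ.comap Smap) hΛ.measurableSet
      rwa [Measure.restrict_eq_self_of_ae_mem hmU] at h
    have hφae : AEMeasurable (φ t) μ := by
      refine AEMeasurable.of_map_ne_zero ?_
      rw [hμ.map_eq t ht]
      exact IsProbabilityMeasure.ne_zero μ
    exact stub_modelMeasureTools_aux_map_comap hemb hΛ.measurableSet hnull hgae (hmaps t ht) (hconj t ht) hφae
      (hμ.map_eq t ht)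
  · rw [hemb.comap_preimage]
    exact measure_mono_null inter_subset_left hs

end Summit.AnomalousDissipation.AnomalousDissipation.Theorems.DenseLoudDesignerForces.Ergodic

end
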